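import Summits.ResolutionOfSingularities.ResolutionOfSingularities.Theorems.FrobeniusLadderFInjectiveMacaulayficationFDStorey1CellTables
import Summits.ResolutionOfSingularities.ResolutionOfSingularities.Theorems.FrobeniusLadderFInjectiveMacaulayficationKLocCellKitOff
import Summits.ResolutionOfSingularities.ResolutionOfSingularities.Theorems.FrobeniusLadderFInjectiveMacaulayficationFanCheckSoundBinders
import HarnessLib

/-!
# KERNEL CHECKS (polynomial side) of the BED D storey-1 certificate: table bridges, the `θ`-identities, the no-variable-divides witnesses, the FEDDER CELLS of all 327 charts
# (`KLocCellKit.checkKs`, p = 2) and the OFF-CELLS of the two P-charts (`KLocCellKit.checkKsOff`) — each ONE `decide +kernel`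
# (crux `FInjectiveMacaulayfication` stmt-ResolutionOfSingularities-15315, chain w45a; (W-TD) BED D storey 1 (D-1), res-L1-w45a-plan-1 R21.18 (4); seat res-L1-w45a-stub-2 g10)

Support file for crux stmt-ResolutionOfSingularities-15315 (`FrobeniusLadder.FInjectiveMacaulayfication`), chain w45a.
[OURS · L1 W4.5a] — NOT a statement of any manuscript; AI-written, weaker than expert review.

On the tables `FDStorey1PolyTables` / `FDStorey1CellTables` (charts of `Bl_{𝔪·K} X_D`, `f_D = z⁴+x⁵z+x⁶+y³+u³+t⁷`, char 2): `hVq`/`hdq` (the local matrix/shift tables agree with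
`FanCheckKit.chartV`/the chart records), `hθ_rawq` (termwise `V_c·e = d_c + e'` along `FL`/`G c`), `hX_raw` (for every chart and variable a term of `g_c` free of it with odd
coefficient class), ★ `hcheck` — EVERY chart's cell package passes `KLocCellKit.checkKs 2` (325 charts: ONE whole-chart Gröbner-cofactor cell `1 ∈ (s_α(Y²)) + (g_c)`, i.e. the strict
transform is F-pure at EVERY point; charts 266/277: the plain cell on `Y₂ = 0`), `hS_empty`/`hS_P` (the strata lists), ★ `hcheckOff266`/`hcheckOff277` + `hOffCover…` (the OFF-cells
`h^m ∈ (s_α(Y²)) + (Y_i) + (g_c)` on `Y₃ = 0`, `Y₄ = 0` for all five avoid generators `Y₀, Y₁, Y₂+1, Y₃, Y₄` — F-pure off their common zero `P`), `hSScovP` (strata cover of the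
P-charts). Consumer: `FDStorey1Fan`. No definitions, no named facts. [folklore; cite: Fedder1983, Thm. 1.12]
-/

-- single-problem summit: the doubled namespace component is forced
set_option linter.dupNamespace false

namespace Summit.ResolutionOfSingularities.ResolutionOfSingularities.Theorems.FInjectiveMacaulayfication.FDStorey1Fan

open Summit.ResolutionOfSingularities.ResolutionOfSingularities.Theorems.FInjectiveMacaulayfication
open FanCheckKit FanCheckSound

/-! ## Bridges of the local tables -/

/-- The local matrix table agrees with `chartV 5 RAYS CL 327`. -/
theorem hVq : ∀ c : Fin 327, Vq c = chartV 5 RAYS CL 327 c := by decide +kernel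

/-- The local shift table agrees with the chart records' exceptional vectors. -/
theorem hdq : ∀ c : Fin 327, dq c = vecOf 5 (getL (chartRec CL c.1).2.2.2 0 []) := by decide +kernel

/-! ## The strict transforms -/

/-- The `θ`-factorisation witnesses: termwise `V_c · e = d_c + e'` (explicit dot products) with equal coefficients, along `FL` / `G c`. -/
theorem hθ_rawq : ∀ c : Fin 327, List.Forall₂ (fun t t' : ℤ × (Fin 5 → ℕ) => t.1 = t'.1 ∧ ∀ i : Fin 5,
    Vq c i 0 * t.2 0 + Vq c i 1 * t.2 1 + Vq c i 2 * t.2 2 + Vq c i 3 * t.2 3 + Vq c i 4 * t.2 4 = dq c i + t'.2 i) FL (G c) := by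
  decide +kernel

/-- For every chart and variable, a term of `g_c` free of that variable whose coefficient class is odd. -/
theorem hX_raw : ∀ (c : Fin 327) (i : Fin 5), ∃ t ∈ G c, t.2 i = 0 ∧
    ¬ ((2 : ℤ) ∣ (((G c).filter fun s : ℤ × (Fin 5 → ℕ) => s.2 = t.2).map fun s : ℤ × (Fin 5 → ℕ) => s.1).sum) := by
  decide +kernel

/-! ## ★ The Fedder cells -/

/-- ★ THE FEDDER CERTIFICATES: every chart's cell package passes the kernel cell check at `p = 2` (325 whole-chart cofactor cells; the plain `Y₂ = 0` cell on the P-charts). -/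
theorem hcheck : ∀ c : Fin 327, KLocCellKit.checkKs 2 (G c) (CELLS c) = true := by decide +kernel

/-- Off the P-charts every package carries the whole-chart cell `S = ∅`. -/
theorem hS_empty : ∀ c : Fin 327, c.val ≠ 266 → c.val ≠ 277 → (∅ : Finset (Fin 5)) ∈ (CELLS c).map Prod.fst := by decide +kernel

/-- The strata lists of the P-charts: the single plain stratum `Y₂ = 0`. -/
theorem hS_P : (CELLS ⟨266, by omega⟩).map Prod.fst = [({2} : Finset (Fin 5))] ∧ (CELLS ⟨277, by omega⟩).map Prod.fst = [({2} : Finset (Fin 5))] := by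
  decide +kernel

/-- ★ The OFF-CELLS of chart 266 pass the kernel off-cell check at `p = 2`. -/
theorem hcheckOff266 : KLocCellKit.checkKsOff 2 (G ⟨266, by omega⟩) OFF266 = true := by decide +kernel

/-- ★ The OFF-CELLS of chart 277 pass the kernel off-cell check at `p = 2`. -/
theorem hcheckOff277 : KLocCellKit.checkKsOff 2 (G ⟨277, by omega⟩) OFF277 = true := by decide +kernel

/-- Every pair (off stratum, avoid generator) has a record, chart 266. -/
theorem hOffCover266 : ∀ S ∈ SSoff, ∀ H ∈ HS, ∃ r ∈ OFF266, r.1 = S ∧ r.2.2.2.2.1 = H := by decide +kernel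

/-- Every pair (off stratum, avoid generator) has a record, chart 277. -/
theorem hOffCover277 : ∀ S ∈ SSoff, ∀ H ∈ HS, ∃ r ∈ OFF277, r.1 = S ∧ r.2.2.2.2.1 = H := by decide +kernel

/-- The strata cover of the P-charts: every zero pattern over the origin contains `{2}`, `{3}` or `{4}` (the rays of rows 2, 3, 4 have all coordinates positive). -/
theorem hSScovP : ∀ c : Fin 327, c.val = 266 ∨ c.val = 277 → ∀ T : Finset (Fin 5), (∀ j ∈ (Finset.univ : Finset (Fin 5)), ∃ i ∈ T, 0 < Vq c i j) →
    (∃ S ∈ [({2} : Finset (Fin 5))], S ⊆ T) ∨ (∃ S ∈ SSoff, S ⊆ T) := by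
  decide +kernel

end Summit.ResolutionOfSingularities.ResolutionOfSingularities.Theorems.FInjectiveMacaulayfication.FDStorey1Fan
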